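import Summits.MatrixMultiplication.MatrixMultiplication.Theorems.FarEdgeDescentSquareGerm
import HarnessLib

/-!
# Route `FarEdgeDescent` — the generic leaf at its anchor: `AnchoredLogConvexity` is a scale-free curvature
floor at the square (lens-2, gen 25; support module, def-free; companion of `FarEdgeDescentSquareGerm`)

The cut of record `ω(ℂ) = 2 ⟺ FiniteSaturation ∧ AnchoredLogConvexity` (`FarEdgeDescentChord.node_iff`) is
unchanged.  Write `f(x) := ω(1,x,1)`, `e(x) := f(x) − (x+1)`, so `e(1) = ω − 2`.  The generic crux
`AnchoredLogConvexity : ∀ m > 1, e(m)² ≤ e(1)·e(2m−1)` is anchored at the SQUARE `m = 1`, the fixed point of the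
fold (see `FarEdgeDescentSquareGerm`).  Read in the step `h := m − 1 > 0` it is, identically,

  `(e(1) − e(1+h))² ≤ e(1)·[e(1+2h) − 2e(1+h) + e(1)]`     (`alc_iff_curvatureFloor`):

(second difference of `f` at the square over step `h`) × (height `e(1)`) ≥ (drop of `e` over step `h`)², at
EVERY scale `h > 0` — a scale-free CURVATURE FLOOR at the anchor.  Consequences:

* under `ω > 2` the drop is strict at every scale (`excess_lt_excess_one_of_not_mm`, from the landed `LogRate`),
  so the leaf forces a STRICT second difference `f(1) + f(1+2h) > 2f(1+h)` for every `h > 0`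
  (`secondDiff_pos_of_alc`): NO AFFINE EXIT from the square (`no_affine_exit_of_alc`) — every polyhedral exit
  (gen 24's `W_poly`, the diagonal world of `FarEdgeDescentDiagonalWorld`, every `TameProfile`) violates the leaf,
  and the leaf plus one affine exit IS the summit (`mm_of_alc_of_affine_exit`).  This is the lineage's
  GENERIC = ROUND reading, now local at the anchor and exact (an `↔`, not a consequence);
* what `closes` consumes of the floor is exactly its value at a scale whose doubled shape is saturated,
  `e(1+2h) = 0 ⟹ e(1+h) = 0` (`halving_of_curvatureFloor`, the halving step of `FarEdgeDescentChord`), along the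
  dyadic scales `h_n = (K−1)/2^{n+1}` below a roof `K` supplied by `FiniteSaturation`.

No `def`s; imports only landed modules; nothing here proves `ω = 2` or decides the crux.
[cite: CoppersmithWinograd1990, §6] [cite: LottiRomani1983, §2 (p. 174)]
-/

set_option linter.dupNamespace false

noncomputable section

namespace Summit.MatrixMultiplication.MatrixMultiplication.Theorems.FarEdgeDescentSquareCurvature

open Literature.Computability.AlgebraicComplexity
open Summit.MatrixMultiplication.MatrixMultiplication.Theses.FarEdgeDescent (AnchoredLogConvexity)
open Summit.MatrixMultiplication.MatrixMultiplication.Theorems.FarEdgeDescentNearVertex (profile_convexOn_univ)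
open Summit.MatrixMultiplication.MatrixMultiplication.Theorems.FarEdgeDescentTameProfile (exists_nat_excess_lt)
open Summit.MatrixMultiplication.MatrixMultiplication.Theorems.FarEdgeDescentSquareGerm (two_lt_omega_of_not_mm)
open Set

/-! ## `AnchoredLogConvexity` = a scale-free curvature floor at the square -/

/-- ★ **`AnchoredLogConvexity` IS A CURVATURE FLOOR AT THE SQUARE.**  With `h := m − 1 > 0` and
`e(x) := f(x) − (x+1)` (`e(1) = ω − 2`), the crux `e(1+h)² ≤ e(1)·e(1+2h)` is IDENTICALLY
`(e(1) − e(1+h))² ≤ e(1)·[e(1+2h) − 2e(1+h) + e(1)]`: (second difference at the square over step `h`) × height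
≥ (drop over step `h`)², at every scale `h > 0`. -/
theorem alc_iff_curvatureFloor :
    AnchoredLogConvexity ↔ ∀ h : ℝ, 0 < h →
      ((omega ℂ - 2) - (omegaRect ℂ 1 (1 + h) 1 - (2 + h))) ^ 2 ≤
        (omega ℂ - 2) * ((omegaRect ℂ 1 (1 + 2 * h) 1 - (2 + 2 * h)) -
          2 * (omegaRect ℂ 1 (1 + h) 1 - (2 + h)) + (omega ℂ - 2)) := by
  have key : ∀ A B C : ℝ, (A - B) ^ 2 - A * (C - 2 * B + A) = B ^ 2 - A * C := fun A B C => by ring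
  constructor
  · intro hA h hh
    have h1 := hA (1 + h) (by linarith)
    rw [omegaRect_one_one_one, show 2 * (1 + h) - 1 = 1 + 2 * h by ring] at h1
    have := key (omega ℂ - 2) (omegaRect ℂ 1 (1 + h) 1 - (2 + h)) (omegaRect ℂ 1 (1 + 2 * h) 1 - (2 + 2 * h))
    nlinarith [h1, this]
  · intro hC m hm
    have h1 := hC (m - 1) (by linarith)
    rw [show 1 + (m - 1) = m by ring, show 1 + 2 * (m - 1) = 2 * m - 1 by ring] at h1
    rw [omegaRect_one_one_one]
    have := key (omega ℂ - 2) (omegaRect ℂ 1 m 1 - (2 + (m - 1))) (omegaRect ℂ 1 (2 * m - 1) 1 - (2 + 2 * (m - 1)))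
    nlinarith [h1, this]

/-- Under `ω > 2` the excess DROPS strictly at every scale: `e(x) < e(1) = ω − 2` for every `x > 1`
(convexity of `f` between the square and a far shape `k ≥ x` with `e(k) < ω − 2`, which `LogRate` supplies). -/
theorem excess_lt_excess_one_of_not_mm (hS : ¬ _root_.MatrixMultiplication) {x : ℝ} (hx : 1 < x) :
    omegaRect ℂ 1 x 1 - (x + 1) < omega ℂ - 2 := by
  have hω := two_lt_omega_of_not_mm hS
  obtain ⟨k, hkx, -, hk⟩ := exists_nat_excess_lt (ε := omega ℂ - 2) (by linarith) x
  have hk1 : (1 : ℝ) < k := lt_of_lt_of_le hx hkx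
  have hsec := profile_convexOn_univ.secant_mono (a := 1) (x := x) (y := (k : ℝ)) (mem_univ _) (mem_univ _)
    (mem_univ _) (ne_of_gt hx) (ne_of_gt hk1) hkx
  rw [omegaRect_one_one_one, div_le_div_iff₀ (sub_pos.2 hx) (sub_pos.2 hk1)] at hsec
  -- hsec : (f x − ω)(k − 1) ≤ (f k − ω)(x − 1), and f k − ω < k − 1
  have hlt : (omegaRect ℂ 1 (k : ℝ) 1 - omega ℂ) * (x - 1) < ((k : ℝ) - 1) * (x - 1) :=
    mul_lt_mul_of_pos_right (by linarith) (sub_pos.2 hx)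
  nlinarith [hsec, hlt, sub_pos.2 hk1, sub_pos.2 hx]

/-- ★ Under `ω > 2` the generic leaf forces a STRICT second difference at the square at EVERY scale:
`e(1+2h) − 2e(1+h) + e(1) > 0` for all `h > 0` (equivalently `f(1) + f(1+2h) > 2f(1+h)`). -/
theorem secondDiff_pos_of_alc (hA : AnchoredLogConvexity) (hS : ¬ _root_.MatrixMultiplication) {h : ℝ}
    (hh : 0 < h) :
    0 < (omegaRect ℂ 1 (1 + 2 * h) 1 - (2 + 2 * h)) - 2 * (omegaRect ℂ 1 (1 + h) 1 - (2 + h)) + (omega ℂ - 2) := by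
  have hfloor := alc_iff_curvatureFloor.1 hA h hh
  have hdrop : 0 < (omega ℂ - 2) - (omegaRect ℂ 1 (1 + h) 1 - (2 + h)) := by
    linarith [excess_lt_excess_one_of_not_mm hS (x := 1 + h) (by linarith)]
  have hω := two_lt_omega_of_not_mm hS
  by_contra hle
  rw [not_lt] at hle
  have h1 : (omega ℂ - 2) * ((omegaRect ℂ 1 (1 + 2 * h) 1 - (2 + 2 * h)) -
      2 * (omegaRect ℂ 1 (1 + h) 1 - (2 + h)) + (omega ℂ - 2)) ≤ 0 :=
    mul_nonpos_of_nonneg_of_nonpos (by linarith) hle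
  nlinarith [hfloor, hdrop, h1, sq_pos_of_pos hdrop]

/-- ★ **NO AFFINE EXIT FROM THE SQUARE.**  Under the generic leaf and `ω > 2`, `f` is affine on NO interval
`[1, 1 + 2h]`, `h > 0` — every polyhedral (`TameProfile`-type) exit, e.g. gen 24's `W_poly` or the diagonal world,
violates the leaf. -/
theorem no_affine_exit_of_alc (hA : AnchoredLogConvexity) (hS : ¬ _root_.MatrixMultiplication) {h : ℝ}
    (hh : 0 < h) :
    ¬ ∃ a c : ℝ, ∀ x ∈ Icc (1 : ℝ) (1 + 2 * h), omegaRect ℂ 1 x 1 = a * x + c := by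
  rintro ⟨a, c, haff⟩
  have h0 := haff 1 ⟨le_rfl, by linarith⟩
  have h1 := haff (1 + h) ⟨by linarith, by linarith⟩
  have h2 := haff (1 + 2 * h) ⟨by linarith, le_rfl⟩
  have hpos := secondDiff_pos_of_alc hA hS hh
  rw [omegaRect_one_one_one] at h0
  rw [h1, h2, h0] at hpos
  linarith

/-- The same, as a route-level reading: the generic leaf plus ONE affine exit from the square give the summit. -/
theorem mm_of_alc_of_affine_exit (hA : AnchoredLogConvexity)
    (hex : ∃ h : ℝ, 0 < h ∧ ∃ a c : ℝ, ∀ x ∈ Icc (1 : ℝ) (1 + 2 * h), omegaRect ℂ 1 x 1 = a * x + c) :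
    _root_.MatrixMultiplication := by
  by_contra hS
  obtain ⟨h, hh, hex'⟩ := hex
  exact no_affine_exit_of_alc hA hS hh hex'

/-- What `closes` consumes of the floor: at a scale `h` whose doubled shape is saturated, `e(1+2h) = 0`, the floor
reads `(e(1) − e(1+h))² ≤ e(1)² − 2e(1)e(1+h)`, i.e. `e(1+h)² ≤ 0` — the HALVING STEP
(`FarEdgeDescentChord.halving_step`), used along `h_n = (K−1)/2^{n+1}`. -/
theorem halving_of_curvatureFloor {h : ℝ}
    (hfloor : ((omega ℂ - 2) - (omegaRect ℂ 1 (1 + h) 1 - (2 + h))) ^ 2 ≤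
      (omega ℂ - 2) * ((omegaRect ℂ 1 (1 + 2 * h) 1 - (2 + 2 * h)) -
        2 * (omegaRect ℂ 1 (1 + h) 1 - (2 + h)) + (omega ℂ - 2)))
    (hsat : omegaRect ℂ 1 (1 + 2 * h) 1 = 2 + 2 * h) :
    omegaRect ℂ 1 (1 + h) 1 = 2 + h := by
  rw [hsat, sub_self] at hfloor
  have hsq : (omegaRect ℂ 1 (1 + h) 1 - (2 + h)) ^ 2 ≤ 0 := by nlinarith [hfloor]
  have h0 : omegaRect ℂ 1 (1 + h) 1 - (2 + h) = 0 := by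
    nlinarith [sq_nonneg (omegaRect ℂ 1 (1 + h) 1 - (2 + h))]
  linarith

end Summit.MatrixMultiplication.MatrixMultiplication.Theorems.FarEdgeDescentSquareCurvature
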